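import Summits.AnomalousDissipation.AnomalousDissipation.Theorems.SoloInformedSpectralFluxBudget

/-!
# The energy-flux floor of a vanishing-viscosity family (solo-informed)

Kernel form of "in any zeroth-law witness the energy injected at the forcing scale is carried by
the nonlinearity out of every finite set of modes, at rate `≥ ε` uniformly in the viscosity".
For a global Leray–Hopf solution `u` of `NS_ν + f` on `T^d` (`ν > 0`, `f` steady smooth mean
zero) and ANY finite family `Ψ₁, …, Ψ_N` of smooth divergence-free fields, summing the exact mode
balances (`lerayHopf_testMode_sq_identity`) shows that the **flux out of the family**
`Π_Ψ := −∑ᵢ (u, Ψᵢ)(u ⊗ u : ∇Ψᵢ)` (for an `L²`-orthonormal family, `((u·∇)u, P_Ψ u)`: the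
spectral energy flux out of the span, Frisch 1995 (6.34)–(6.36); for the divergence-free Fourier
modes of frequency `≤ K`, the flux `Π_K`) pays for what the force injects into the family, up to
the family's own `O(ν)` dissipation; the Leray–Hopf energy inequality and Cauchy–Schwarz–Jensen
for the unreproduced force `f − f_Ψ`, `f_Ψ := ∑ᵢ (f, Ψᵢ) Ψᵢ`, then give, with
`Λ_Ψ = ∑ᵢ ‖Ψᵢ‖₂‖ΔΨᵢ‖₂`:

* `lerayHopf_timeMean_dissipation_le_testFamilyFlux` — for every `T > 0`,
  `⟨ν‖∇u‖²⟩_T ≤ ⟨Π_Ψ⟩_T + ν Λ_Ψ ⟨‖u‖²⟩_T + ‖f − f_Ψ‖₂ ⟨‖u‖²⟩_T^{1/2} + C T⁻¹`;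
* `lerayHopf_meanDissipation_le_testFamilyFlux` — the `limsup` (long-time) version;
* `fluxFloor_testFamily_of_vanishingViscosity` / `…_eventually` — along ANY vanishing-viscosity
  family on `T³` with one steady force, `⟨‖u_j‖²⟩ ≤ E`, `⟨ν_j‖∇u_j‖²⟩ ≥ ε`:
  `ε ≤ ⟨Π_Ψ(u_j)⟩ + ν_j Λ_Ψ E + ‖f − f_Ψ‖₂ √E`, so through every finite set of modes reproducing
  `f` the witness transports energy at rate `≥ ε − o(1)`: a persistent forward cascade through
  EVERY wavenumber, uniformly in `ν`, with no regularity hypothesis (twin of the 4/5-law floor);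
* `anomalousDissipation_imp_testFamilyFluxFloor` — the zeroth law implies all of this for its witness.

References: U. Frisch, *Turbulence* (CUP 1995) §6.2 [Frisch1995]; Doering–Foias, J. Fluid
Mech. 467 (2002) §2 [DoeringFoias2002]; Temam (1984) Ch. III [Temam1984].
-/

noncomputable section

open MeasureTheory Filter Topology Set
open scoped ENNReal NNReal InnerProductSpace RealInnerProductSpace

namespace Summit.AnomalousDissipation.AnomalousDissipation.Theorems

open Literature.Analysis.FunctionSpaces Literature.Analysis.FluidPDE

variable {d : Type*} [Fintype d] [DecidableEq d]

section OneSolution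

variable {ν : ℝ} {f u₀ : UnitAddTorus d → EuclideanSpace ℝ d}
  {u : ℝ → UnitAddTorus d → EuclideanSpace ℝ d}

/-- **Finite-family flux budget, running means.** For a global Leray–Hopf solution of `NS_ν + f`
(`ν > 0`, `f` steady smooth mean-zero) and any finite family `Ψ` of smooth divergence-free test
fields there is `C` with, for every `T > 0`,
`⟨ν‖∇u‖²⟩_T ≤ ⟨Π_Ψ⟩_T + ν Λ_Ψ ⟨‖u‖²⟩_T + ‖f − f_Ψ‖₂ ⟨‖u‖²⟩_T^{1/2} + C T⁻¹`, where
`Π_Ψ = −∑ᵢ (u, Ψᵢ)(u ⊗ u : ∇Ψᵢ)` is the energy flux out of the family (Frisch 1995 (6.34)–(6.36)),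
`Λ_Ψ = ∑ᵢ ‖Ψᵢ‖₂‖ΔΨᵢ‖₂` and `f_Ψ = ∑ᵢ (f, Ψᵢ) Ψᵢ`. [cite: Frisch1995, §6.2 (6.34)–(6.36)] -/
theorem lerayHopf_timeMean_dissipation_le_testFamilyFlux (hν : 0 < ν) (hf : Torus.IsSmooth f)
    (hmean : Torus.HasZeroMean f) {ι : Type*} [Fintype ι]
    {Ψ : ι → UnitAddTorus d → EuclideanSpace ℝ d} (hΨ : ∀ i, Torus.IsSmooth (Ψ i))
    (hΨdiv : ∀ i, Torus.IsDivFree (Ψ i)) (hu : Torus.IsGlobalLerayHopf ν (fun _ => f) u₀ u) :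
    ∃ C : ℝ, ∀ T, 0 < T →
      timeMean (fun s => ν * (Torus.eGradNormSq (u s)).toReal) T ≤
        timeMean (fun s => -∑ i, (∫ x, ⟪u s x, Ψ i x⟫)
            * ∫ x, ⟪u s x, Torus.convect (u s) (Ψ i) x⟫) T
        + ν * (∑ i, Real.sqrt (∫ x, ‖Ψ i x‖ ^ 2)
            * Real.sqrt (∫ x, ‖Torus.laplacian (Ψ i) x‖ ^ 2))
            * timeMean (fun s => ∫ x, ‖u s x‖ ^ 2) T
        + Real.sqrt (∫ x, ‖f x - ∑ i, (∫ y, ⟪f y, Ψ i y⟫) • Ψ i x‖ ^ 2)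
            * Real.sqrt (timeMean (fun s => ∫ x, ‖u s x‖ ^ 2) T)
        + C * T⁻¹ := by
  classical
  obtain ⟨R, hR⟩ := hu.exists_forall_integral_norm_sq_le_of_hasZeroMean hν (hf.memLp 2) hmean
  refine ⟨Torus.kineticEnergy u₀ + 2⁻¹ * R * ∑ i, ∫ x, ‖Ψ i x‖ ^ 2, fun T hT => ?_⟩
  have hmem : ∀ s, 0 ≤ s → MemLp (u s) 2 volume := fun s hs => hu.memLp_two hs
  have hint : ∀ s, 0 ≤ s → Integrable (u s) volume := fun s hs =>
    (hmem s hs).integrable one_le_two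
  have hΨc : ∀ i, Continuous (Ψ i) := fun i => (hΨ i).continuous
  have hfc : Continuous f := hf.continuous
  have hfΨc : Continuous fun x => ∑ i, (∫ y, ⟪f y, Ψ i y⟫) • Ψ i x := by fun_prop
  have hrc : Continuous fun x => f x - ∑ i, (∫ y, ⟪f y, Ψ i y⟫) • Ψ i x := by fun_prop
  have ha_le : ∀ i s, 0 ≤ s → |∫ x, ⟪u s x, Ψ i x⟫| ≤
      Real.sqrt (∫ x, ‖u s x‖ ^ 2) * Real.sqrt (∫ x, ‖Ψ i x‖ ^ 2) := fun i s hs =>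
    abs_integral_inner_le_sqrt_mul_sqrt (hmem s hs) ((hΨ i).memLp 2)
  have hL_le : ∀ i s, 0 ≤ s → |∫ x, ⟪u s x, Torus.laplacian (Ψ i) x⟫| ≤
      Real.sqrt (∫ x, ‖u s x‖ ^ 2) * Real.sqrt (∫ x, ‖Torus.laplacian (Ψ i) x‖ ^ 2) :=
    fun i s hs => abs_integral_inner_le_sqrt_mul_sqrt (hmem s hs) ((hΨ i).laplacian.memLp 2)
  have hI_a : ∀ i, IntervalIntegrable (fun s => ∫ x, ⟪u s x, Ψ i x⟫) volume 0 T := fun i => by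
    rw [intervalIntegrable_iff_integrableOn_Ioc_of_le hT.le]
    exact (integrableOn_Ioc_iff_integrableOn_Ioo).mpr
      ((hu T hT).integrableOn_integral_inner (hΨc i))
  have hGi : ∀ i, IntegrableOn (fun s => ∫ x, (⟪u s x, Torus.convect (u s) (Ψ i) x⟫
      + ν * ⟪u s x, Torus.laplacian (Ψ i) x⟫ + ⟪f x, Ψ i x⟫)) (Ioo 0 T) := fun i =>
    (hu T hT).integrableOn_flux (aestronglyMeasurable_stLift_steady hf.continuous _)
      (lintegral_Ioo_lintegral_enorm_sq_steady_lt_top (hf.memLp 2) T) (hΨ i)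
  have hI_aG : ∀ i, IntervalIntegrable (fun s => (∫ x, ⟪u s x, Ψ i x⟫)
      * ∫ x, (⟪u s x, Torus.convect (u s) (Ψ i) x⟫ + ν * ⟪u s x, Torus.laplacian (Ψ i) x⟫
        + ⟪f x, Ψ i x⟫)) volume 0 T := fun i => by
    rw [intervalIntegrable_iff_integrableOn_Ioc_of_le hT.le]
    exact (integrableOn_Ioc_iff_integrableOn_Ioo).mpr
      (lerayHopf_integrableOn_inner_mul hu (hΨc i) hT (hGi i))
  have hI_aL : ∀ i, IntervalIntegrable (fun s => (∫ x, ⟪u s x, Ψ i x⟫)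
      * ∫ x, ⟪u s x, Torus.laplacian (Ψ i) x⟫) volume 0 T := fun i => by
    rw [intervalIntegrable_iff_integrableOn_Ioc_of_le hT.le]
    exact (integrableOn_Ioc_iff_integrableOn_Ioo).mpr
      (lerayHopf_integrableOn_inner_mul hu (hΨc i) hT
        ((hu T hT).integrableOn_integral_inner (hΨ i).laplacian.continuous))
  have hsplit : ∀ i, ∀ s ∈ Ioc (0:ℝ) T, (∫ x, (⟪u s x, Torus.convect (u s) (Ψ i) x⟫
      + ν * ⟪u s x, Torus.laplacian (Ψ i) x⟫ + ⟪f x, Ψ i x⟫)) =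
      (∫ x, ⟪u s x, Torus.convect (u s) (Ψ i) x⟫) + ν * (∫ x, ⟪u s x, Torus.laplacian (Ψ i) x⟫)
        + ∫ y, ⟪f y, Ψ i y⟫ := by
    intro i s hs
    have i1 : Integrable (fun x => ⟪u s x, Torus.convect (u s) (Ψ i) x⟫) volume :=
      Torus.integrable_inner_convect_self (hmem s hs.1.le) (hΨ i)
    have i2 : Integrable (fun x => ⟪u s x, Torus.laplacian (Ψ i) x⟫) volume :=
      Torus.integrable_inner_of_continuous (hint s hs.1.le) (hΨ i).laplacian.continuous
    have i3 : Integrable (fun x => ⟪f x, Ψ i x⟫) volume :=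
      Torus.integrable_inner_of_continuous ((hf.memLp 2).integrable one_le_two) (hΨc i)
    have i12 : Integrable (fun x => ⟪u s x, Torus.convect (u s) (Ψ i) x⟫
        + ν * ⟪u s x, Torus.laplacian (Ψ i) x⟫) volume := i1.add (i2.const_mul ν)
    rw [integral_add i12 i3, integral_add i1 (i2.const_mul ν), integral_const_mul]
  have hI_aS : ∀ i, IntervalIntegrable (fun s => (∫ x, ⟪u s x, Ψ i x⟫)
      * ∫ x, ⟪u s x, Torus.convect (u s) (Ψ i) x⟫) volume 0 T := fun i => by
    refine ((hI_aG i).sub (((hI_aL i).const_mul ν).add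
      ((hI_a i).const_mul (∫ y, ⟪f y, Ψ i y⟫)))).congr fun s hs => ?_
    rw [uIoc_of_le hT.le] at hs
    show (∫ x, ⟪u s x, Ψ i x⟫) * (∫ x, (⟪u s x, Torus.convect (u s) (Ψ i) x⟫
        + ν * ⟪u s x, Torus.laplacian (Ψ i) x⟫ + ⟪f x, Ψ i x⟫))
      - (ν * ((∫ x, ⟪u s x, Ψ i x⟫) * ∫ x, ⟪u s x, Torus.laplacian (Ψ i) x⟫)
        + (∫ y, ⟪f y, Ψ i y⟫) * ∫ x, ⟪u s x, Ψ i x⟫)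
      = (∫ x, ⟪u s x, Ψ i x⟫) * ∫ x, ⟪u s x, Torus.convect (u s) (Ψ i) x⟫
    rw [hsplit i s hs]
    ring
  have hI_e : IntervalIntegrable (fun s => ∫ x, ‖u s x‖ ^ 2) volume 0 T :=
    (intervalIntegrable_iff_integrableOn_Ioc_of_le hT.le).2 (hu.integrableOn_integral_norm_sq hT)
  have hI_r : IntervalIntegrable
      (fun s => ∫ x, ⟪u s x, f x - ∑ i, (∫ y, ⟪f y, Ψ i y⟫) • Ψ i x⟫) volume 0 T := by
    rw [intervalIntegrable_iff_integrableOn_Ioc_of_le hT.le]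
    exact (integrableOn_Ioc_iff_integrableOn_Ioo).mpr ((hu T hT).integrableOn_integral_inner hrc)
  have hI_p : IntervalIntegrable (fun s => ∫ x, ⟪f x, u s x⟫) volume 0 T :=
    (hu T hT).intervalIntegrable_power hT hν (hf.memLp 2) hmean
  have hpow : ∀ s ∈ Ioc (0:ℝ) T, (∫ x, ⟪f x, u s x⟫) =
      (∑ i, (∫ y, ⟪f y, Ψ i y⟫) * ∫ x, ⟪u s x, Ψ i x⟫)
        + ∫ x, ⟪u s x, f x - ∑ i, (∫ y, ⟪f y, Ψ i y⟫) • Ψ i x⟫ := by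
    intro s hs
    have hus := hint s hs.1.le
    have i1 : ∀ i, Integrable (fun x => ⟪u s x, Ψ i x⟫) volume := fun i =>
      Torus.integrable_inner_of_continuous hus (hΨc i)
    have i2 : Integrable (fun x => ⟪u s x, ∑ i, (∫ y, ⟪f y, Ψ i y⟫) • Ψ i x⟫) volume :=
      Torus.integrable_inner_of_continuous hus hfΨc
    have i3 : Integrable (fun x => ⟪u s x, f x - ∑ i, (∫ y, ⟪f y, Ψ i y⟫) • Ψ i x⟫) volume :=
      Torus.integrable_inner_of_continuous hus hrc
    have h1 : ∀ x, ⟪f x, u s x⟫ = ⟪u s x, ∑ i, (∫ y, ⟪f y, Ψ i y⟫) • Ψ i x⟫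
        + ⟪u s x, f x - ∑ i, (∫ y, ⟪f y, Ψ i y⟫) • Ψ i x⟫ := fun x => by
      rw [← inner_add_right, real_inner_comm (u s x) (f x)]
      congr 1
      abel
    have h2 : ∀ x, ⟪u s x, ∑ i, (∫ y, ⟪f y, Ψ i y⟫) • Ψ i x⟫ =
        ∑ i, (∫ y, ⟪f y, Ψ i y⟫) * ⟪u s x, Ψ i x⟫ := fun x => by
      rw [inner_sum]
      simp only [real_inner_smul_right]
    simp_rw [h1]
    rw [integral_add i2 i3]
    congr 1
    simp_rw [h2]
    rw [integral_finsetSum _ fun i _ => (i1 i).const_mul _]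
    simp only [integral_const_mul]
  have haL : ∀ i, ∀ s ∈ Icc (0:ℝ) T,
      -((∫ x, ⟪u s x, Ψ i x⟫) * ∫ x, ⟪u s x, Torus.laplacian (Ψ i) x⟫) ≤
        (Real.sqrt (∫ x, ‖Ψ i x‖ ^ 2) * Real.sqrt (∫ x, ‖Torus.laplacian (Ψ i) x‖ ^ 2))
          * ∫ x, ‖u s x‖ ^ 2 := by
    intro i s hs
    have h1 := ha_le i s hs.1
    have h2 := hL_le i s hs.1
    have he : Real.sqrt (∫ x, ‖u s x‖ ^ 2) * Real.sqrt (∫ x, ‖u s x‖ ^ 2) = ∫ x, ‖u s x‖ ^ 2 :=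
      Real.mul_self_sqrt (integral_nonneg fun x => sq_nonneg _)
    have h3 := mul_le_mul h1 h2 (abs_nonneg _) ((abs_nonneg _).trans h1)
    rw [← abs_mul] at h3
    calc -((∫ x, ⟪u s x, Ψ i x⟫) * ∫ x, ⟪u s x, Torus.laplacian (Ψ i) x⟫)
        ≤ |(∫ x, ⟪u s x, Ψ i x⟫) * ∫ x, ⟪u s x, Torus.laplacian (Ψ i) x⟫| := neg_le_abs _
      _ ≤ _ := h3
      _ = (Real.sqrt (∫ x, ‖Ψ i x‖ ^ 2) * Real.sqrt (∫ x, ‖Torus.laplacian (Ψ i) x‖ ^ 2))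
          * (Real.sqrt (∫ x, ‖u s x‖ ^ 2) * Real.sqrt (∫ x, ‖u s x‖ ^ 2)) := by ring
      _ = _ := by rw [he]
  have hbd : ∀ i, (∫ x, ⟪u T x, Ψ i x⟫) ^ 2 ≤ R * ∫ x, ‖Ψ i x‖ ^ 2 := by
    intro i
    have h1 := ha_le i T hT.le
    have hq0 : 0 ≤ ∫ x, ‖Ψ i x‖ ^ 2 := integral_nonneg fun x => sq_nonneg _
    calc (∫ x, ⟪u T x, Ψ i x⟫) ^ 2 = |∫ x, ⟪u T x, Ψ i x⟫| ^ 2 := (sq_abs _).symm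
      _ ≤ (Real.sqrt (∫ x, ‖u T x‖ ^ 2) * Real.sqrt (∫ x, ‖Ψ i x‖ ^ 2)) ^ 2 :=
          pow_le_pow_left₀ (abs_nonneg _) h1 2
      _ = (∫ x, ‖u T x‖ ^ 2) * ∫ x, ‖Ψ i x‖ ^ 2 := by
          rw [mul_pow, Real.sq_sqrt (integral_nonneg fun x => sq_nonneg _), Real.sq_sqrt hq0]
      _ ≤ R * ∫ x, ‖Ψ i x‖ ^ 2 := mul_le_mul_of_nonneg_right (hR T hT.le) hq0
  have hEI := (hu T hT).intervalIntegral_dissipation_le hT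
  have hJ' := lerayHopf_abs_timeMean_inner_le_of_continuous hu hrc hT
  have hJ : (∫ s in (0:ℝ)..T, ∫ x, ⟪u s x, f x - ∑ i, (∫ y, ⟪f y, Ψ i y⟫) • Ψ i x⟫) ≤
      T * (Real.sqrt (∫ x, ‖f x - ∑ i, (∫ y, ⟪f y, Ψ i y⟫) • Ψ i x‖ ^ 2)
        * Real.sqrt (timeMean (fun s => ∫ x, ‖u s x‖ ^ 2) T)) := by
    have h1 : (∫ s in (0:ℝ)..T, ∫ x, ⟪u s x, f x - ∑ i, (∫ y, ⟪f y, Ψ i y⟫) • Ψ i x⟫) =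
        T * timeMean (fun s => ∫ x, ⟪u s x, f x - ∑ i, (∫ y, ⟪f y, Ψ i y⟫) • Ψ i x⟫) T := by
      unfold timeMean
      rw [mul_inv_cancel_left₀ hT.ne']
    rw [h1]
    exact mul_le_mul_of_nonneg_left ((le_abs_self _).trans hJ') hT.le
  have hmode : ∀ i, (∫ x, ⟪u T x, Ψ i x⟫) ^ 2 - (∫ x, ⟪u₀ x, Ψ i x⟫) ^ 2 =
      2 * ∫ s in (0:ℝ)..T, (∫ x, ⟪u s x, Ψ i x⟫) * ∫ x, (⟪u s x, Torus.convect (u s) (Ψ i) x⟫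
        + ν * ⟪u s x, Torus.laplacian (Ψ i) x⟫ + ⟪f x, Ψ i x⟫) :=
    fun i => lerayHopf_testMode_sq_identity hf (hΨ i) (hΨdiv i) hu hT
  have key := fluxBudget_core hT hν.le (D := fun s => ν * (Torus.eGradNormSq (u s)).toReal)
    (p := fun s => ∫ x, ⟪f x, u s x⟫)
    (r := fun s => ∫ x, ⟪u s x, f x - ∑ i, (∫ y, ⟪f y, Ψ i y⟫) • Ψ i x⟫)
    (e := fun s => ∫ x, ‖u s x‖ ^ 2) (a := fun i s => ∫ x, ⟪u s x, Ψ i x⟫)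
    (S := fun i s => ∫ x, ⟪u s x, Torus.convect (u s) (Ψ i) x⟫)
    (L := fun i s => ∫ x, ⟪u s x, Torus.laplacian (Ψ i) x⟫)
    (G := fun i s => ∫ x, (⟪u s x, Torus.convect (u s) (Ψ i) x⟫
      + ν * ⟪u s x, Torus.laplacian (Ψ i) x⟫ + ⟪f x, Ψ i x⟫))
    (b := fun i => ∫ x, ⟪u₀ x, Ψ i x⟫) (c := fun i => ∫ y, ⟪f y, Ψ i y⟫)
    (q := fun i => ∫ x, ‖Ψ i x‖ ^ 2)
    (w := fun i => Real.sqrt (∫ x, ‖Ψ i x‖ ^ 2)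
      * Real.sqrt (∫ x, ‖Torus.laplacian (Ψ i) x‖ ^ 2))
    (E₀ := Torus.kineticEnergy u₀) (R := R)
    (J := Real.sqrt (∫ x, ‖f x - ∑ i, (∫ y, ⟪f y, Ψ i y⟫) • Ψ i x‖ ^ 2)
      * Real.sqrt (timeMean (fun s => ∫ x, ‖u s x‖ ^ 2) T))
    hI_aS hI_aL hI_a hI_e hI_r hI_p hmode hsplit hpow haL hbd hEI hJ
  exact timeMean_le_of_integral_le hT key

/-- **Finite-family flux budget, long-time means**: `⟨ν‖∇u‖²⟩ ≤ ⟨Π_Ψ⟩ + ν Λ_Ψ ⟨‖u‖²⟩ +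
‖f − f_Ψ‖₂ ⟨‖u‖²⟩^{1/2}` (`limsup` averages; the Cesàro means of `Π_Ψ` and of the energy are
bounded, so every `limsup` is honest and commutes with the monotone continuous
`y ↦ ν Λ_Ψ y + ‖f − f_Ψ‖₂ √y`). [cite: Frisch1995, §6.2 (6.34)–(6.36)] -/
theorem lerayHopf_meanDissipation_le_testFamilyFlux (hν : 0 < ν) (hf : Torus.IsSmooth f)
    (hmean : Torus.HasZeroMean f) {ι : Type*} [Fintype ι]
    {Ψ : ι → UnitAddTorus d → EuclideanSpace ℝ d} (hΨ : ∀ i, Torus.IsSmooth (Ψ i))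
    (hΨdiv : ∀ i, Torus.IsDivFree (Ψ i)) (hu : Torus.IsGlobalLerayHopf ν (fun _ => f) u₀ u) :
    meanDissipation ν u ≤
      longTimeAvgSup (fun s => -∑ i, (∫ x, ⟪u s x, Ψ i x⟫)
          * ∫ x, ⟪u s x, Torus.convect (u s) (Ψ i) x⟫)
      + ν * (∑ i, Real.sqrt (∫ x, ‖Ψ i x‖ ^ 2)
          * Real.sqrt (∫ x, ‖Torus.laplacian (Ψ i) x‖ ^ 2)) * meanEnergy u
      + Real.sqrt (∫ x, ‖f x - ∑ i, (∫ y, ⟪f y, Ψ i y⟫) • Ψ i x‖ ^ 2)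
          * Real.sqrt (meanEnergy u) := by
  obtain ⟨C, hC⟩ := lerayHopf_timeMean_dissipation_le_testFamilyFlux hν hf hmean hΨ hΨdiv hu
  obtain ⟨R, hR⟩ := hu.exists_forall_integral_norm_sq_le_of_hasZeroMean hν (hf.memLp 2) hmean
  obtain ⟨Λ, hΛ⟩ : ∃ Λ : ℝ, Λ = ν * ∑ i, Real.sqrt (∫ x, ‖Ψ i x‖ ^ 2)
      * Real.sqrt (∫ x, ‖Torus.laplacian (Ψ i) x‖ ^ 2) := ⟨_, rfl⟩
  obtain ⟨δ, hδ⟩ : ∃ δ : ℝ, δ = Real.sqrt (∫ x, ‖f x - ∑ i, (∫ y, ⟪f y, Ψ i y⟫) • Ψ i x‖ ^ 2) :=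
    ⟨_, rfl⟩
  rw [← hΛ, ← hδ]
  rw [← hΛ, ← hδ] at hC
  have hΛ0 : 0 ≤ Λ := by
    rw [hΛ]
    exact mul_nonneg hν.le (Finset.sum_nonneg fun i _ =>
      mul_nonneg (Real.sqrt_nonneg _) (Real.sqrt_nonneg _))
  have hδ0 : 0 ≤ δ := by rw [hδ]; exact Real.sqrt_nonneg _
  have hh : Monotone fun y : ℝ => Λ * y + δ * Real.sqrt y := fun y z hyz =>
    add_le_add (mul_le_mul_of_nonneg_left hyz hΛ0)
      (mul_le_mul_of_nonneg_left (Real.sqrt_le_sqrt hyz) hδ0)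
  have hhc : Continuous fun y : ℝ => Λ * y + δ * Real.sqrt y :=
    (continuous_const.mul continuous_id).add (continuous_const.mul Real.continuous_sqrt)
  have hGb : ∀ i, ∃ Cg : ℝ, 0 ≤ Cg ∧ ∀ x, ∑ j, ‖Torus.partialDeriv j (Ψ i) x‖ ≤ Cg := fun i =>
    Torus.exists_sum_norm_partialDeriv_le (hΨ i)
  choose Cg hCg0 hCg using hGb
  have hR0 : 0 ≤ R := (integral_nonneg fun x => sq_nonneg _).trans (hR 0 le_rfl)
  have hPipt : ∀ s, 0 ≤ s → |-∑ i, (∫ x, ⟪u s x, Ψ i x⟫)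
      * ∫ x, ⟪u s x, Torus.convect (u s) (Ψ i) x⟫| ≤
      ∑ i, Real.sqrt R * Real.sqrt (∫ x, ‖Ψ i x‖ ^ 2) * (Cg i * R) := by
    intro s hs
    have hmem : MemLp (u s) 2 volume := hu.memLp_two hs
    rw [abs_neg]
    refine (Finset.abs_sum_le_sum_abs _ _).trans (Finset.sum_le_sum fun i _ => ?_)
    rw [abs_mul]
    have h1 : |∫ x, ⟪u s x, Ψ i x⟫| ≤ Real.sqrt R * Real.sqrt (∫ x, ‖Ψ i x‖ ^ 2) :=
      (abs_integral_inner_le_sqrt_mul_sqrt hmem ((hΨ i).memLp 2)).trans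
        (mul_le_mul_of_nonneg_right (Real.sqrt_le_sqrt (hR s hs)) (Real.sqrt_nonneg _))
    have h2 : |∫ x, ⟪u s x, Torus.convect (u s) (Ψ i) x⟫| ≤ Cg i * R :=
      (Torus.abs_integral_inner_convect_self_le hmem (hΨ i) (hCg i)).trans
        (mul_le_mul_of_nonneg_left (hR s hs) (hCg0 i))
    exact mul_le_mul h1 h2 (abs_nonneg _) (mul_nonneg (Real.sqrt_nonneg _) (Real.sqrt_nonneg _))
  set B : ℝ := ∑ i, Real.sqrt R * Real.sqrt (∫ x, ‖Ψ i x‖ ^ 2) * (Cg i * R) with hB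
  have hp : ∀ᶠ T in atTop, |timeMean (fun s => -∑ i, (∫ x, ⟪u s x, Ψ i x⟫)
      * ∫ x, ⟪u s x, Torus.convect (u s) (Ψ i) x⟫) T| ≤ max B R :=
    (eventually_gt_atTop 0).mono fun T hT =>
      (abs_timeMean_le hT fun t ht _ => hPipt t ht.le).trans (le_max_left _ _)
  have hm0 : ∀ᶠ T in atTop, 0 ≤ timeMean (fun s => ∫ x, ‖u s x‖ ^ 2) T :=
    (eventually_ge_atTop 0).mono fun T hT =>
      timeMean_nonneg (fun t => integral_nonneg fun x => sq_nonneg _) hT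
  have hmB : ∀ᶠ T in atTop, timeMean (fun s => ∫ x, ‖u s x‖ ^ 2) T ≤ max B R :=
    (eventually_gt_atTop 0).mono fun T hT => by
      have h1 : |timeMean (fun s => ∫ x, ‖u s x‖ ^ 2) T| ≤ R :=
        abs_timeMean_le hT fun t ht _ => by
          rw [abs_of_nonneg (integral_nonneg fun x => sq_nonneg _)]
          exact hR t ht.le
      exact ((le_abs_self _).trans h1).trans (le_max_right _ _)
  have hx0 : ∀ᶠ T in atTop, 0 ≤ timeMean (fun s => ν * (Torus.eGradNormSq (u s)).toReal) T :=
    (eventually_ge_atTop 0).mono fun T hT =>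
      timeMean_nonneg (fun t => mul_nonneg hν.le ENNReal.toReal_nonneg) hT
  have hle : ∀ᶠ T in atTop, timeMean (fun s => ν * (Torus.eGradNormSq (u s)).toReal) T ≤
      timeMean (fun s => -∑ i, (∫ x, ⟪u s x, Ψ i x⟫)
          * ∫ x, ⟪u s x, Torus.convect (u s) (Ψ i) x⟫) T
        + (Λ * timeMean (fun s => ∫ x, ‖u s x‖ ^ 2) T
          + δ * Real.sqrt (timeMean (fun s => ∫ x, ‖u s x‖ ^ 2) T)) + C * T⁻¹ :=
    (eventually_gt_atTop 0).mono fun T hT => by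
      have := hC T hT
      linarith
  have key := limsup_le_limsup_add_map_limsup (h := fun y => Λ * y + δ * Real.sqrt y) hh hhc hx0
    hp hm0 hmB hle
  rw [← add_assoc] at key
  exact key

end OneSolution

/-! ### Vanishing-viscosity families on `T³` -/

/-- The physical flat unit torus `T³ = (ℝ/ℤ)³` (local notation). -/
local notation "𝕋³" => UnitAddTorus (Fin 3)
/-- Velocity values on `T³` (local notation). -/
local notation "E³" => EuclideanSpace ℝ (Fin 3)

/-- **The energy-flux floor of a vanishing-viscosity family.** Along any family of global
Leray–Hopf solutions on `T³` with one steady smooth mean-zero force, `ν_j > 0`, `⟨‖u_j‖²⟩ ≤ E`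
and `⟨ν_j‖∇u_j‖²⟩ ≥ ε`, the mean energy flux out of EVERY finite family `Ψ` of smooth
divergence-free test fields obeys `ε ≤ ⟨Π_Ψ(u_j)⟩ + ν_j Λ_Ψ E + ‖f − f_Ψ‖₂ √E` for every `j`.
[cite: Frisch1995, §6.2 (6.34)–(6.36)] -/
theorem fluxFloor_testFamily_of_vanishingViscosity {f : 𝕋³ → E³} (hf : Torus.IsSmooth f)
    (hmean : Torus.HasZeroMean f) {ν : ℕ → ℝ} {u₀ : ℕ → 𝕋³ → E³} {u : ℕ → ℝ → 𝕋³ → E³}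
    (hν : ∀ j, 0 < ν j) (hLH : ∀ j, Torus.IsGlobalLerayHopf (ν j) (fun _ => f) (u₀ j) (u j))
    {E : ℝ} (hE : ∀ j, meanEnergy (u j) ≤ E) {ε : ℝ}
    (hεle : ∀ j, ε ≤ meanDissipation (ν j) (u j)) {ι : Type*} [Fintype ι] {Ψ : ι → 𝕋³ → E³}
    (hΨ : ∀ i, Torus.IsSmooth (Ψ i)) (hΨdiv : ∀ i, Torus.IsDivFree (Ψ i)) (j : ℕ) :
    ε ≤ longTimeAvgSup (fun s => -∑ i, (∫ x, ⟪u j s x, Ψ i x⟫)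
          * ∫ x, ⟪u j s x, Torus.convect (u j s) (Ψ i) x⟫)
      + ν j * (∑ i, Real.sqrt (∫ x, ‖Ψ i x‖ ^ 2)
          * Real.sqrt (∫ x, ‖Torus.laplacian (Ψ i) x‖ ^ 2)) * E
      + Real.sqrt (∫ x, ‖f x - ∑ i, (∫ y, ⟪f y, Ψ i y⟫) • Ψ i x‖ ^ 2) * Real.sqrt E := by
  have h := lerayHopf_meanDissipation_le_testFamilyFlux (hν j) hf hmean hΨ hΨdiv (hLH j)
  have hΛ0 : 0 ≤ ν j * ∑ i, Real.sqrt (∫ x, ‖Ψ i x‖ ^ 2)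
      * Real.sqrt (∫ x, ‖Torus.laplacian (Ψ i) x‖ ^ 2) :=
    mul_nonneg (hν j).le (Finset.sum_nonneg fun i _ =>
      mul_nonneg (Real.sqrt_nonneg _) (Real.sqrt_nonneg _))
  have h1 := mul_le_mul_of_nonneg_left (hE j) hΛ0
  have h2 := mul_le_mul_of_nonneg_left (Real.sqrt_le_sqrt (hE j))
    (Real.sqrt_nonneg (∫ x, ‖f x - ∑ i, (∫ y, ⟪f y, Ψ i y⟫) • Ψ i x‖ ^ 2))
  linarith [hεle j]

/-- **Eventual form**: since `ν_j → 0`, for every `η > 0` and all large `j`,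
`⟨Π_Ψ(u_j)⟩ ≥ ε − ‖f − f_Ψ‖₂ √E − η`; for a family reproducing `f` (`f_Ψ = f`, e.g. all
divergence-free Fourier modes up to any `K ≥ K_f`) the flux out of the family is `≥ ε − o(1)`:
a persistent forward energy cascade through every finite set of modes, uniformly in the
viscosity. [cite: Frisch1995, §6.2 (6.34)–(6.36)] -/
theorem fluxFloor_testFamily_eventually {f : 𝕋³ → E³} (hf : Torus.IsSmooth f)
    (hmean : Torus.HasZeroMean f) {ν : ℕ → ℝ} {u₀ : ℕ → 𝕋³ → E³} {u : ℕ → ℝ → 𝕋³ → E³}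
    (hν : ∀ j, 0 < ν j) (hν0 : Tendsto ν atTop (𝓝 0))
    (hLH : ∀ j, Torus.IsGlobalLerayHopf (ν j) (fun _ => f) (u₀ j) (u j))
    {E : ℝ} (hE : ∀ j, meanEnergy (u j) ≤ E) {ε : ℝ}
    (hεle : ∀ j, ε ≤ meanDissipation (ν j) (u j)) {ι : Type*} [Fintype ι] {Ψ : ι → 𝕋³ → E³}
    (hΨ : ∀ i, Torus.IsSmooth (Ψ i)) (hΨdiv : ∀ i, Torus.IsDivFree (Ψ i)) {η : ℝ} (hη : 0 < η) :
    ∀ᶠ j in atTop, ε - Real.sqrt (∫ x, ‖f x - ∑ i, (∫ y, ⟪f y, Ψ i y⟫) • Ψ i x‖ ^ 2) * Real.sqrt E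
        - η ≤ longTimeAvgSup (fun s => -∑ i, (∫ x, ⟪u j s x, Ψ i x⟫)
          * ∫ x, ⟪u j s x, Torus.convect (u j s) (Ψ i) x⟫) := by
  have hΛE : Tendsto (fun j => ν j * (∑ i, Real.sqrt (∫ x, ‖Ψ i x‖ ^ 2)
      * Real.sqrt (∫ x, ‖Torus.laplacian (Ψ i) x‖ ^ 2)) * E) atTop (𝓝 0) := by
    have h := (hν0.mul_const (∑ i, Real.sqrt (∫ x, ‖Ψ i x‖ ^ 2)
      * Real.sqrt (∫ x, ‖Torus.laplacian (Ψ i) x‖ ^ 2))).mul_const E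
    rwa [zero_mul, zero_mul] at h
  filter_upwards [hΛE.eventually (gt_mem_nhds hη)] with j hj
  have := fluxFloor_testFamily_of_vanishingViscosity hf hmean hν hLH hE hεle hΨ hΨdiv j
  linarith

/-- **The zeroth law forces a persistent cascade through every finite set of modes**: if
`AnomalousDissipation` holds, its witness family satisfies the energy-flux floor for every
finite family of smooth divergence-free test fields (stated for families indexed by `Fin N`).
[cite: Frisch1995, §6.2 (6.34)–(6.36)] -/
theorem anomalousDissipation_imp_testFamilyFluxFloor (h : _root_.AnomalousDissipation) :
    ∃ f : 𝕋³ → E³, Torus.IsSmooth f ∧ Torus.IsDivFree f ∧ Torus.HasZeroMean f ∧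
      ∃ (ν : ℕ → ℝ) (u₀ : ℕ → 𝕋³ → E³) (u : ℕ → ℝ → 𝕋³ → E³),
        (∀ j, 0 < ν j) ∧ Tendsto ν atTop (𝓝 0) ∧
        (∀ j, Torus.IsGlobalLerayHopf (ν j) (fun _ => f) (u₀ j) (u j)) ∧
        ∃ E ε : ℝ, 0 < ε ∧ (∀ j, meanEnergy (u j) ≤ E) ∧
          (∀ j, ε ≤ meanDissipation (ν j) (u j)) ∧
          ∀ (N : ℕ) (Ψ : Fin N → 𝕋³ → E³), (∀ i, Torus.IsSmooth (Ψ i)) →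
            (∀ i, Torus.IsDivFree (Ψ i)) →
            (∀ j, ε ≤ longTimeAvgSup (fun s => -∑ i, (∫ x, ⟪u j s x, Ψ i x⟫)
                  * ∫ x, ⟪u j s x, Torus.convect (u j s) (Ψ i) x⟫)
              + ν j * (∑ i, Real.sqrt (∫ x, ‖Ψ i x‖ ^ 2)
                  * Real.sqrt (∫ x, ‖Torus.laplacian (Ψ i) x‖ ^ 2)) * E
              + Real.sqrt (∫ x, ‖f x - ∑ i, (∫ y, ⟪f y, Ψ i y⟫) • Ψ i x‖ ^ 2) * Real.sqrt E) ∧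
            ∀ η : ℝ, 0 < η → ∀ᶠ j in atTop,
              ε - Real.sqrt (∫ x, ‖f x - ∑ i, (∫ y, ⟪f y, Ψ i y⟫) • Ψ i x‖ ^ 2) * Real.sqrt E - η
                ≤ longTimeAvgSup (fun s => -∑ i, (∫ x, ⟪u j s x, Ψ i x⟫)
                  * ∫ x, ⟪u j s x, Torus.convect (u j s) (Ψ i) x⟫) := by
  obtain ⟨f, hf, hdiv, hmean, ν, u₀, u, hν, hν0, hLH, ⟨E, hE⟩, ε, hε, hεle⟩ := h
  exact ⟨f, hf, hdiv, hmean, ν, u₀, u, hν, hν0, hLH, E, ε, hε, hE, hεle, fun N Ψ hΨ hΨdiv =>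
    ⟨fluxFloor_testFamily_of_vanishingViscosity hf hmean hν hLH hE hεle hΨ hΨdiv,
      fun η hη => fluxFloor_testFamily_eventually hf hmean hν hν0 hLH hE hεle hΨ hΨdiv hη⟩⟩

end Summit.AnomalousDissipation.AnomalousDissipation.Theorems

end
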